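import Mathlib
import Literature.Computability.Complexity.ForsterIsotropicPositionProof
import HarnessLib

/-!
# The Forster decomposition: the densest-subspace peel (Hopkins–Kane–Lovett–Mahajan 2020,
# Cor. 4.20 / Thm. 8.2; Diakonikolas–Kane–Tzamos 2021, Thm. 1.4, Thm. 2.1), exact form

Sources. M. Hopkins, D. Kane, S. Lovett, G. Mahajan, *Point location and active learning: learning
halfspaces almost optimally*, FOCS 2020 = arXiv:2004.11380 [HopkinsEtAl2020]: Lemma 4.19 (a weighted
finite point set `(X ⊂ ℝ^d, μ)` can be put in `ε`-isotropic position for every `ε > 0` iff every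
`k`-dimensional subspace `V` has `μ(V ∩ X) ≤ k/d`), Corollary 4.20 (for some `1 ≤ k ≤ d` there is a
`k`-dimensional `V` with `μ(X ∩ V) ≥ k/d` whose points can be put in `ε`-isotropic position inside
`V`; proof by induction on `d` through a densest subspace), Theorem 8.2 (EXACT isotropic position
exists iff every proper subspace has `μ(X ∩ V) < k/d`, or `= k/d` with the rest of the mass in a
complement).  I. Diakonikolas, D. Kane, C. Tzamos, *Forster decomposition and learning halfspaces
with noise*, NeurIPS 2021 = arXiv:2107.05582 [DiakonikolasKaneTzamos2021]: Theorem 2.1 (the exact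
existence theorem in the strict form, attributed to HKLM: "unless there is a proper subspace `W` of
`V` so that `Pr[X ∈ W] ≥ dim(W)/dim(V)`, there exists an invertible `A : V → V` such that
`Σ_A = (1/dim V) I`"), Theorem 1.4 + the paragraph after it p. 6 (a subspace `V` containing at least a
`dim(V)/d` fraction of the points with a Forster transform on it; "by applying [this] iteratively to
the points of `S ∖ (S ∩ V)`, we obtain a decomposition of `S` into not too many subsets `T`, so that
each `T` has a Forster transform over the subspace which it spans" — the FORSTER DECOMPOSITION).

## What is here (all proved; no named facts)

Sections `Mass`–`Dense`: the COMBINATORIAL half of the Forster decomposition, for an arbitrary finite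
weighted family of nonzero vectors `u : X → V`, `μ : X → ℝ_{>0}` on `R : Finset X`, in a
finite-dimensional vector space `V` over any division ring `K` (the statements only involve spans,
dimensions and masses):

* `IsStrictlyDense K u μ T` — the strict subspace-mass inequality of `(u, μ)|_T` inside its own span
  `W_T = span (u '' T)`: every nonzero proper `W' < W_T` has `μ{x ∈ T : u x ∈ W'}·dim W_T < μ(T)·dim W'`
  (the hypothesis of the exact weighted radial-isotropic-position theorem, DKT Thm. 2.1 / HKLM
  Thm. 8.2 strict case / Barthe 1998; `W_T` is then strictly the densest subspace for `T`).
* `exists_dense_strict` — THE PEEL STEP, exact form: some subspace `W = span (u '' T)`,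
  `T = {x ∈ R : u x ∈ W} ≠ ∅`, carries at least its dimensional share `μ(R)·dim W ≤ μ(T)·dim V` AND
  is strictly dense.  Proof: the MINIMAL-dimensional subspace among those of MAXIMAL density
  `μ{u ∈ W}/dim W` (a finite search over spans of sub-families); a nonzero proper sub-subspace of equal
  density would contradict minimality, so the inequality inside `W` is strict — this is why the exact
  transform (and not only HKLM's `ε`-approximate one, Cor. 4.20) is available on every piece.
* `exists_decomposition` — THE DECOMPOSITION: a rank function `piece : X → ℕ` (`piece x < |R|`)
  whose level sets `T_i` are each strictly dense (when nonempty), each taking at least a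
  `dim W_i / dim V ≥ 1/dim V` fraction of the mass not assigned before it, so that the tail obeys
  `μ{piece ≥ j} ≤ (1 − 1/dim V)^j μ(R)` (`≤ e^{−j/dim V} μ(R)`, `one_sub_div_pow_le_exp`): at most
  `⌈dim V · ln(1/η)⌉` pieces leave an `η`-light remainder.
* small API: `mass`, `inSub` (the indices whose vectors lie in a subspace), `mem_inSub`.

Section `Transforms` (`V = ℝ^k`, `X : Type` finite): the ANALYTIC half is the weighted exact
radial-isotropic-position theorem PROVED in `ForsterIsotropicPositionProof.lean` Part V
(`Forster.exists_isotropic_submodule`, from `weightedRadialIsotropicPosition` = DKT Thm. 2.1); here it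
is attached to the pieces:
* `IsStrictlyDense.barthe` — a strictly dense piece satisfies that theorem's hypothesis relative to
  its span;
* `IsStrictlyDense.exists_isotropic` — a strictly dense piece admits a linear isomorphism
  `P : W_T ≅ ℝ^r` (`r = dim W_T`, with a section `L`) such that
  `∑_{x∈T} μ_x ⟨Pu_x,w⟩²/‖Pu_x‖² = (μ(T)/r)‖w‖²` for all `w ∈ ℝ^r`;
* `exists_forster_decomposition` — THE FORSTER DECOMPOSITION WITH ITS TRANSFORMS: rank function,
  tail `≤ (1 − 1/k)^j μ(R)`, and on every nonempty piece such a `P_i, L_i`.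

## What is NOT here

* `ε`-approximate positions (HKLM Lemma 4.19, Cor. 4.20 as printed): not needed once the peel is taken
  at the minimal densest subspace (every piece gets an EXACT transform).
* The matrix form `∑ μ_x (Pu_x)(Pu_x)ᵀ/‖Pu_x‖² = (μ(T)/r)·I_r` of the quadratic-form identity:
  polarise, cf. `Forster.entries_of_quadForm_w` in `ForsterIsotropicPositionProof.lean`.
* General finite-dimensional real inner product spaces in section `Transforms` (stated for `ℝ^k`
  with the dot product, the form the Forster files and their consumers use), and index types in
  higher universes there (`X : Type`, inherited from `Forster.exists_isotropic_submodule`).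
* Algorithms / bit complexity (DKT 2021 Thm. 1.4, Diakonikolas–Tzamos–Kane STOC 2023): not formalised.

Motivation (cell `PneNP/ChebyshevTracialDesign`, literature memo LIT-33): for a rank-one psd field
`X_U = x(U) v(U)v(U)ᵀ` on an index set of "cuts", `exists_decomposition` with `u = v`, `μ = x` is a
psd-preserving partition of the cuts into `≤ r·ln(1/η)` pieces plus an `η`-light remainder, each piece
living in its own subspace in exact weighted isotropic position — the printed "directional" half of a
decomposition programme.  Nothing here is specific to that application.

## References
* [HopkinsEtAl2020] M. Hopkins, D. Kane, S. Lovett, G. Mahajan, *Point location and active learning: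
  learning halfspaces almost optimally*, FOCS 2020, Lemma 4.19, Corollary 4.20, Theorem 8.2.
* [DiakonikolasKaneTzamos2021] I. Diakonikolas, D. M. Kane, C. Tzamos, *Forster decomposition and
  learning halfspaces with noise*, NeurIPS 2021, Theorem 1.4, Theorem 2.1, Proposition 2.2.
* [Forster2002] J. Forster, *A linear lower bound on the unbounded error probabilistic communication
  complexity*, JCSS 65 (2002), Theorem 4.1.
-/

noncomputable section

namespace Literature.Computability.Complexity

namespace ForsterDecomposition

open Finset Module

variable {K : Type*} [DivisionRing K] {V : Type*} [AddCommGroup V] [Module K V]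
variable {X : Type*}

/-! ## Masses of finite index sets -/

section Mass

variable (μ : X → ℝ)

/-- The `μ`-mass of a finite set of indices, `mass μ T = ∑_{x ∈ T} μ x`. [folklore] -/
def mass (T : Finset X) : ℝ := ∑ x ∈ T, μ x

/-- The empty set has mass `0`. [folklore] -/
@[simp] private theorem mass_empty : mass μ (∅ : Finset X) = 0 := by simp [mass]

/-- Nonnegative weights give nonnegative mass. [folklore] -/
private theorem mass_nonneg {T : Finset X} (h : ∀ x ∈ T, 0 ≤ μ x) : 0 ≤ mass μ T :=
  Finset.sum_nonneg h

/-- Positive weights on a nonempty set give positive mass. [folklore] -/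
private theorem mass_pos {T : Finset X} (hT : T.Nonempty) (h : ∀ x ∈ T, 0 < μ x) : 0 < mass μ T :=
  Finset.sum_pos h hT

/-- Splitting the mass of `T` along a predicate. [folklore] -/
private theorem mass_filter_add_mass_filter_not (T : Finset X) (p : X → Prop) [DecidablePred p] :
    mass μ (T.filter p) + mass μ (T.filter fun x => ¬ p x) = mass μ T := by
  unfold mass
  exact Finset.sum_filter_add_sum_filter_not T p μ

end Mass

/-! ## The indices whose vectors lie in a subspace -/

section InSub

variable (u : X → V) [∀ (W : Submodule K V) (v : V), Decidable (v ∈ W)]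

/-- `inSub u T W`: the indices `x ∈ T` whose vector `u x` lies in the subspace `W`. [folklore] -/
def inSub (T : Finset X) (W : Submodule K V) : Finset X := T.filter fun x => u x ∈ W

/-- Membership in `inSub u T W` — the formal counterpart of the sources' `X ∩ V` ("the points of `X`
lying in the subspace `V`"). [cite: HopkinsEtAl2020, Corollary 4.20 (notation `X ∩ V`)] -/
theorem mem_inSub {T : Finset X} {W : Submodule K V} {x : X} :
    x ∈ inSub u T W ↔ x ∈ T ∧ u x ∈ W :=
  Finset.mem_filter

/-- `inSub u T W ⊆ T`. [folklore] -/
private theorem inSub_subset (T : Finset X) (W : Submodule K V) : inSub u T W ⊆ T :=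
  Finset.filter_subset _ _

/-- Restricting first to `W` and then to a smaller `W' ≤ W` is restricting to `W'`. [folklore] -/
private theorem inSub_inSub_of_le (T : Finset X) {W W' : Submodule K V} (h : W' ≤ W) :
    inSub u (inSub u T W) W' = inSub u T W' := by
  ext x
  simp only [mem_inSub]
  constructor
  · rintro ⟨⟨hx, _⟩, h'⟩
    exact ⟨hx, h'⟩
  · rintro ⟨hx, h'⟩
    exact ⟨⟨hx, h h'⟩, h'⟩

/-- The vectors indexed by `inSub u T W` span a subspace of `W`. [folklore] -/
private theorem span_image_inSub_le (T : Finset X) (W : Submodule K V) :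
    Submodule.span K (u '' ↑(inSub u T W)) ≤ W := by
  rw [Submodule.span_le]
  rintro _ ⟨x, hx, rfl⟩
  exact ((mem_inSub u).1 (Finset.mem_coe.1 hx)).2

variable (K) in
/-- Every `S ⊆ T` lies in the part of `T` captured by the span of `u '' S`. [folklore] -/
private theorem subset_inSub_span {S T : Finset X} (hST : S ⊆ T) :
    S ⊆ inSub u T (Submodule.span K (u '' ↑S)) := by
  intro x hx
  rw [mem_inSub]
  exact ⟨hST hx, Submodule.subset_span ⟨x, Finset.mem_coe.2 hx, rfl⟩⟩

variable (K) in
/-- All of `T` is captured by the span of its own vectors. [folklore] -/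
private theorem inSub_span_self (T : Finset X) : inSub u T (Submodule.span K (u '' ↑T)) = T :=
  Finset.Subset.antisymm (inSub_subset u _ _) (subset_inSub_span K u (Finset.Subset.refl T))

variable (K) in
/-- For `S ⊆ T`, the part of `T` captured by `span (u '' S)` spans exactly `span (u '' S)`.
[folklore] -/
private theorem span_image_inSub_span {S T : Finset X} (hST : S ⊆ T) :
    Submodule.span K (u '' ↑(inSub u T (Submodule.span K (u '' ↑S)))) =
      Submodule.span K (u '' ↑S) :=
  le_antisymm (span_image_inSub_le u _ _)
    (Submodule.span_mono (Set.image_mono (Finset.coe_subset.2 (subset_inSub_span K u hST))))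

end InSub

section Span

variable (K) (u : X → V)

/-- A nonempty family of nonzero vectors spans a nonzero subspace. [folklore] -/
private theorem span_image_ne_bot {T : Finset X} (hT : T.Nonempty) (hu : ∀ x ∈ T, u x ≠ 0) :
    Submodule.span K (u '' ↑T) ≠ ⊥ := by
  obtain ⟨x, hx⟩ := hT
  rw [Submodule.ne_bot_iff]
  exact ⟨u x, Submodule.subset_span ⟨x, Finset.mem_coe.2 hx, rfl⟩, hu x hx⟩

/-- A nonempty family of nonzero vectors spans a subspace of positive dimension. [folklore] -/
private theorem finrank_span_image_pos [FiniteDimensional K V] {T : Finset X} (hT : T.Nonempty)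
    (hu : ∀ x ∈ T, u x ≠ 0) : 0 < finrank K (Submodule.span K (u '' ↑T)) :=
  Submodule.one_le_finrank_iff.2 (span_image_ne_bot K u hT hu)

end Span

/-! ## The strict subspace-mass inequality and the densest-subspace lemma -/

section Dense

variable (K) (u : X → V) (μ : X → ℝ) [∀ (W : Submodule K V) (v : V), Decidable (v ∈ W)]
variable [FiniteDimensional K V]

/-- **The strict subspace-mass inequality** for the weighted family `(u, μ)` restricted to the index
set `T`, inside its own span `W_T := span (u '' T)`: every nonzero proper subspace `W' < W_T` carries
STRICTLY LESS than its dimensional share of the mass of `T`,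
`μ{x ∈ T : u x ∈ W'} · dim W_T < μ(T) · dim W'`.
This is the hypothesis of the exact radial-isotropic-position theorem in its weighted form
(Barthe 1998; Hopkins–Kane–Lovett–Mahajan 2020, Thm. 8.2, strict case; Diakonikolas–Kane–Tzamos
2021, Thm. 2.1: "unless there is a proper subspace `W` of `V` so that `Pr[X ∈ W] ≥ dim(W)/dim(V)`,
there exists an invertible linear transformation `A : V → V` such that `Σ_A = (1/dim V)·I`").
[cite: DiakonikolasKaneTzamos2021, Theorem 2.1] -/
def IsStrictlyDense (T : Finset X) : Prop :=
  ∀ W' : Submodule K V, W' < Submodule.span K (u '' ↑T) → W' ≠ ⊥ →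
    mass μ (inSub u T W') * (finrank K (Submodule.span K (u '' ↑T)) : ℝ) <
      mass μ T * (finrank K W' : ℝ)

/-- The part of `R` captured by the span of a candidate index set `S` (the "closure" of `S` in `R`).
[folklore] -/
private def clos (R S : Finset X) : Finset X := inSub u R (Submodule.span K (u '' ↑S))

/-- The density of a candidate index set `S ⊆ R`: captured mass over dimension of the span.
[folklore] -/
private def dens (R S : Finset X) : ℝ :=
  mass μ (clos K u R S) / (finrank K (Submodule.span K (u '' ↑S)) : ℝ)

/-- **The densest-subspace lemma (the peel step of the Forster decomposition, exact form).**
For a nonempty finite family of nonzero vectors `u x` with positive weights `μ x` (`x ∈ R`) in a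
finite-dimensional space `V` there is a subspace `W` such that, with `T := {x ∈ R : u x ∈ W}`:
`T ≠ ∅`, `W = span (u '' T)`, `W` carries at least its dimensional share of the total mass,
`μ(R) · dim W ≤ μ(T) · dim V`, and `(u, μ)|_T` satisfies the STRICT subspace-mass inequality inside
`W` (`IsStrictlyDense`).  Proof: take `W` of maximal density `μ{u ∈ W}/dim W` among spans of
sub-families and, among those, of minimal dimension; a nonzero proper `W' < W` of equal density would
contradict minimality.  This is the structural step behind Hopkins–Kane–Lovett–Mahajan's
Corollary 4.20 ("for some `1 ≤ k ≤ d` … a `k`-dimensional subspace `V` with `μ(X ∩ V) ≥ k/d` and an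
invertible `T : V → V` putting `X ∩ V` in `ε`-isotropic position") and Diakonikolas–Kane–Tzamos's
Theorem 1.4 ("a subspace `V` containing at least a `dim(V)/d`-fraction of the points … and a Forster
transform on `V`"); choosing the minimal densest subspace makes the inequality strict, so that the
EXACT transform exists on the piece (HKLM Thm. 8.2 / DKT Thm. 2.1) and no `ε` is needed.
[cite: HopkinsEtAl2020, Corollary 4.20 and Theorem 8.2] -/
theorem exists_dense_strict (R : Finset X) (hR : R.Nonempty) (hu : ∀ x ∈ R, u x ≠ 0)
    (hμ : ∀ x ∈ R, 0 < μ x) :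
    ∃ W : Submodule K V, (inSub u R W).Nonempty ∧ Submodule.span K (u '' ↑(inSub u R W)) = W ∧
      mass μ R * (finrank K W : ℝ) ≤ mass μ (inSub u R W) * (finrank K V : ℝ) ∧
      IsStrictlyDense K u μ (inSub u R W) := by
  -- candidates: the nonempty sub-families of `R`
  set C : Finset (Finset X) := R.powerset.filter fun S => S.Nonempty with hC
  have hCmem : ∀ S ∈ C, S ⊆ R ∧ S.Nonempty := fun S hS => by
    simpa [hC, Finset.mem_filter, Finset.mem_powerset] using hS
  have hmemC : ∀ S, S ⊆ R → S.Nonempty → S ∈ C := fun S h1 h2 => by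
    simp [hC, Finset.mem_filter, Finset.mem_powerset, h1, h2]
  have hRC : R ∈ C := hmemC R (Finset.Subset.refl R) hR
  have hCne : C.Nonempty := ⟨R, hRC⟩
  have hm_pos : ∀ S ∈ C, 0 < finrank K (Submodule.span K (u '' ↑S)) := fun S hS =>
    finrank_span_image_pos K u (hCmem S hS).2 fun x hx => hu x ((hCmem S hS).1 hx)
  -- Step A: a candidate of maximal density
  obtain ⟨S₁, hS₁C, hS₁max⟩ := C.exists_max_image (dens K u μ R) hCne
  -- Step B: among the candidates of maximal density, one whose span has minimal dimension
  set C' : Finset (Finset X) := C.filter fun S => dens K u μ R S = dens K u μ R S₁ with hC'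
  have hC'ne : C'.Nonempty := ⟨S₁, by simp [hC', hS₁C]⟩
  obtain ⟨S₂, hS₂C', hS₂min⟩ :=
    C'.exists_min_image (fun S => finrank K (Submodule.span K (u '' ↑S))) hC'ne
  have hS₂C : S₂ ∈ C := (Finset.mem_filter.1 hS₂C').1
  have hρS₂ : dens K u μ R S₂ = dens K u μ R S₁ := (Finset.mem_filter.1 hS₂C').2
  obtain ⟨hS₂R, hS₂ne⟩ := hCmem S₂ hS₂C
  have hmax : ∀ S ∈ C, dens K u μ R S ≤ dens K u μ R S₂ := fun S hS => by
    rw [hρS₂]; exact hS₁max S hS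
  -- the subspace `W := span (u '' S₂)`; its piece is `clos R S₂ ⊇ S₂`
  have hTsup : S₂ ⊆ clos K u R S₂ := subset_inSub_span K u hS₂R
  have hTne : (clos K u R S₂).Nonempty := hS₂ne.mono hTsup
  have hTR : clos K u R S₂ ⊆ R := inSub_subset u _ _
  have hspan : Submodule.span K (u '' ↑(clos K u R S₂)) = Submodule.span K (u '' ↑S₂) :=
    span_image_inSub_span K u hS₂R
  have hmS : (0 : ℝ) < finrank K (Submodule.span K (u '' ↑S₂)) := by exact_mod_cast hm_pos S₂ hS₂C
  have hmassT : 0 < mass μ (clos K u R S₂) := mass_pos μ hTne fun x hx => hμ x (hTR hx)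
  refine ⟨Submodule.span K (u '' ↑S₂), hTne, hspan, ?_, ?_⟩
  · -- fair share: `dens R ≤ dens S₂`
    have h1 : dens K u μ R R ≤ dens K u μ R S₂ := hmax R hRC
    have hmR : (0 : ℝ) < finrank K (Submodule.span K (u '' ↑R)) := by exact_mod_cast hm_pos R hRC
    have h2 : mass μ R / (finrank K (Submodule.span K (u '' ↑R)) : ℝ) ≤
        mass μ (clos K u R S₂) / (finrank K (Submodule.span K (u '' ↑S₂)) : ℝ) := by
      simpa only [dens, clos, inSub_span_self] using h1
    rw [div_le_div_iff₀ hmR hmS] at h2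
    have hmRV : (finrank K (Submodule.span K (u '' ↑R)) : ℝ) ≤ finrank K V := by
      exact_mod_cast Submodule.finrank_le _
    calc mass μ R * (finrank K (Submodule.span K (u '' ↑S₂)) : ℝ)
        ≤ mass μ (clos K u R S₂) * finrank K (Submodule.span K (u '' ↑R)) := h2
      _ ≤ mass μ (clos K u R S₂) * finrank K V := mul_le_mul_of_nonneg_left hmRV hmassT.le
  · -- strictness inside `W`
    intro W' hW'lt hW'ne
    have hspan' : Submodule.span K (u '' ↑(inSub u R (Submodule.span K (u '' ↑S₂)))) =
        Submodule.span K (u '' ↑S₂) := hspan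
    rw [hspan'] at hW'lt
    have hW'le : W' ≤ Submodule.span K (u '' ↑S₂) := hW'lt.le
    change mass μ (inSub u (clos K u R S₂) W') *
        (finrank K (Submodule.span K (u '' ↑(clos K u R S₂))) : ℝ) < mass μ (clos K u R S₂) * _
    rw [hspan, show inSub u (clos K u R S₂) W' = inSub u R W' from inSub_inSub_of_le u R hW'le]
    have hfinW' : 1 ≤ finrank K W' := Submodule.one_le_finrank_iff.2 hW'ne
    rcases (inSub u R W').eq_empty_or_nonempty with hS'e | hS'ne
    · -- nothing of `R` lies in `W'`
      rw [hS'e, mass_empty, zero_mul]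
      exact mul_pos hmassT (by exact_mod_cast hfinW')
    · -- `S' := inSub R W'` is a candidate of smaller dimension, hence of smaller density
      have hS'R : inSub u R W' ⊆ R := inSub_subset u R W'
      have hS'C : inSub u R W' ∈ C := hmemC _ hS'R hS'ne
      have hspS' : Submodule.span K (u '' ↑(inSub u R W')) ≤ W' := span_image_inSub_le u R W'
      have hmlt : finrank K (Submodule.span K (u '' ↑(inSub u R W'))) <
          finrank K (Submodule.span K (u '' ↑S₂)) :=
        lt_of_le_of_lt (Submodule.finrank_mono hspS') (Submodule.finrank_lt_finrank_of_lt hW'lt)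
      have hclS' : clos K u R (inSub u R W') = inSub u R W' := by
        apply Finset.Subset.antisymm
        · intro x hx
          rw [clos, mem_inSub] at hx
          rw [mem_inSub]
          exact ⟨hx.1, hspS' hx.2⟩
        · exact subset_inSub_span K u hS'R
      have hρle : dens K u μ R (inSub u R W') ≤ dens K u μ R S₂ := hmax _ hS'C
      have hρne : dens K u μ R (inSub u R W') ≠ dens K u μ R S₂ := by
        intro h
        have hS'C' : inSub u R W' ∈ C' := by
          simp [hC', hS'C, h, hρS₂]
        exact absurd (hS₂min _ hS'C') (not_le.2 hmlt)
      have hρlt : dens K u μ R (inSub u R W') < dens K u μ R S₂ := lt_of_le_of_ne hρle hρne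
      have hmS' : (0 : ℝ) < finrank K (Submodule.span K (u '' ↑(inSub u R W'))) := by
        exact_mod_cast hm_pos _ hS'C
      have h3 : mass μ (inSub u R W') / (finrank K (Submodule.span K (u '' ↑(inSub u R W'))) : ℝ)
          < mass μ (clos K u R S₂) / (finrank K (Submodule.span K (u '' ↑S₂)) : ℝ) := by
        simpa only [dens, hclS'] using hρlt
      rw [div_lt_div_iff₀ hmS' hmS] at h3
      have hmW' : (finrank K (Submodule.span K (u '' ↑(inSub u R W'))) : ℝ) ≤ finrank K W' := by
        exact_mod_cast Submodule.finrank_mono hspS'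
      calc mass μ (inSub u R W') * (finrank K (Submodule.span K (u '' ↑S₂)) : ℝ)
          < mass μ (clos K u R S₂) * finrank K (Submodule.span K (u '' ↑(inSub u R W'))) := h3
        _ ≤ mass μ (clos K u R S₂) * finrank K W' := mul_le_mul_of_nonneg_left hmW' hmassT.le

/-! ## The Forster decomposition: iterating the peel -/

/-- **The Forster decomposition (exact form; Diakonikolas–Kane–Tzamos 2021, Thm. 1.4 and the
paragraph following it, after Hopkins–Kane–Lovett–Mahajan 2020, Cor. 4.20).**
Every finite family of nonzero vectors `u x` with positive weights `μ x` (`x ∈ R`) in a space of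
dimension `d = dim V` is PARTITIONED by a rank function `piece : X → ℕ` into pieces
`T_i := {x ∈ R : piece x = i}` (`i < |R|`) such that
* every nonempty piece satisfies the strict subspace-mass inequality inside its own span
  (`IsStrictlyDense`; so each piece admits an EXACT weighted radial isotropic position on
  `span (u '' T_i)` — DKT Thm. 2.1 / HKLM Thm. 8.2),
* each piece carries at least a `dim W_i/d ≥ 1/d` fraction of the mass not yet assigned before it,
  `μ{piece ≥ i} · dim W_i ≤ d · μ(T_i)` (`W_i = span (u '' T_i)`) and `μ{piece ≥ i} ≤ d · μ(T_i)`, hence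
* the tail decays geometrically, `μ{x ∈ R : piece x ≥ j} ≤ (1 − 1/d)^j · μ(R)`: after
  `⌈d · ln(1/η)⌉` pieces at most an `η`-fraction of the mass is left.
("By applying [the theorem] iteratively to the points of `S ∖ (S ∩ V)`, we obtain a decomposition of
`S` into not too many subsets `T`, so that each `T` has a Forster transform over the subspace which it
spans" — DKT 2021, after Thm. 1.4; the piece of each round is the minimal densest subspace of the
remaining family, `exists_dense_strict`.)
[cite: DiakonikolasKaneTzamos2021, Theorem 1.4 and §1.2] -/
theorem exists_decomposition (R : Finset X) (hu : ∀ x ∈ R, u x ≠ 0) (hμ : ∀ x ∈ R, 0 < μ x) :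
    ∃ piece : X → ℕ,
      (∀ x ∈ R, piece x < R.card) ∧
      (∀ i, (R.filter fun x => piece x = i).Nonempty →
        IsStrictlyDense K u μ (R.filter fun x => piece x = i)) ∧
      (∀ i, mass μ (R.filter fun x => i ≤ piece x) ≤
        (finrank K V : ℝ) * mass μ (R.filter fun x => piece x = i)) ∧
      (∀ i, mass μ (R.filter fun x => i ≤ piece x) *
          (finrank K (Submodule.span K (u '' ↑(R.filter fun x => piece x = i))) : ℝ) ≤
        (finrank K V : ℝ) * mass μ (R.filter fun x => piece x = i)) ∧
      (∀ j, mass μ (R.filter fun x => j ≤ piece x) ≤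
        (1 - 1 / (finrank K V : ℝ)) ^ j * mass μ R) := by
  revert hu hμ
  refine Finset.strongInductionOn R fun R ih => ?_
  intro hu hμ
  rcases R.eq_empty_or_nonempty with hRe | hR
  · -- nothing to decompose
    subst hRe
    refine ⟨fun _ => 0, ?_, ?_, ?_, ?_, ?_⟩
    · intro x hx; simp at hx
    · intro i hi; simp at hi
    · intro i; simp
    · intro i; simp
    · intro j; simp
  -- peel the minimal densest subspace `W` off `R`
  obtain ⟨W, hTne, hspan, hfair, hstrict⟩ := exists_dense_strict K u μ R hR hu hμ
  set R' : Finset X := R.filter fun x => ¬ u x ∈ W with hR'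
  have hR'R : R' ⊆ R := Finset.filter_subset _ _
  have hR'ss : R' ⊂ R := by
    obtain ⟨x, hx⟩ := hTne
    rw [mem_inSub] at hx
    exact Finset.filter_ssubset.2 ⟨x, hx.1, not_not.2 hx.2⟩
  obtain ⟨piece', h1', h2', h3', h3s', h4'⟩ :=
    ih R' hR'ss (fun x hx => hu x (hR'R hx)) (fun x hx => hμ x (hR'R hx))
  -- the rank function: round `0` is the piece `inSub u R W`, later rounds are those of `R'`, shifted
  let piece : X → ℕ := fun x => if u x ∈ W then 0 else piece' x + 1
  have hP0 : (R.filter fun x => piece x = 0) = inSub u R W := by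
    ext x
    simp only [Finset.mem_filter, mem_inSub, piece]
    constructor
    · rintro ⟨hx, h⟩
      by_cases hxW : u x ∈ W
      · exact ⟨hx, hxW⟩
      · simp [hxW] at h
    · rintro ⟨hx, hxW⟩
      exact ⟨hx, by simp [hxW]⟩
  have hPsucc : ∀ i, (R.filter fun x => piece x = i + 1) = R'.filter fun x => piece' x = i := by
    intro i
    ext x
    simp only [Finset.mem_filter, hR', piece]
    constructor
    · rintro ⟨hx, h⟩
      by_cases hxW : u x ∈ W
      · simp [hxW] at h
      · simp only [hxW, if_false, add_left_inj] at h
        exact ⟨⟨hx, hxW⟩, h⟩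
    · rintro ⟨⟨hx, hxW⟩, h⟩
      exact ⟨hx, by simp [hxW, h]⟩
  have hT0 : (R.filter fun x => 0 ≤ piece x) = R := by simp
  have hTsucc : ∀ j, (R.filter fun x => j + 1 ≤ piece x) = R'.filter fun x => j ≤ piece' x := by
    intro j
    ext x
    simp only [Finset.mem_filter, hR', piece]
    constructor
    · rintro ⟨hx, h⟩
      by_cases hxW : u x ∈ W
      · simp [hxW] at h
      · simp only [hxW, if_false, add_le_add_iff_right] at h
        exact ⟨⟨hx, hxW⟩, h⟩
    · rintro ⟨⟨hx, hxW⟩, h⟩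
      exact ⟨hx, by simpa [hxW] using h⟩
  -- masses
  have hsplit : mass μ (inSub u R W) + mass μ R' = mass μ R :=
    mass_filter_add_mass_filter_not μ R fun x => u x ∈ W
  have hW1 : 1 ≤ finrank K W := by
    rw [← hspan]
    exact finrank_span_image_pos K u hTne fun x hx => hu x (inSub_subset u R W hx)
  have hd1 : (1 : ℝ) ≤ finrank K V := by exact_mod_cast hW1.trans (Submodule.finrank_le W)
  have hdpos : (0 : ℝ) < finrank K V := by linarith
  have hRnn : 0 ≤ mass μ R := mass_nonneg μ fun x hx => (hμ x hx).le
  have hfair' : mass μ R ≤ (finrank K V : ℝ) * mass μ (inSub u R W) := by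
    have hW1' : (1 : ℝ) ≤ finrank K W := by exact_mod_cast hW1
    nlinarith [hfair, hRnn, hW1']
  have hq : 0 ≤ 1 - 1 / (finrank K V : ℝ) := by
    rw [sub_nonneg, div_le_one hdpos]
    exact hd1
  have hR'le : mass μ R' ≤ (1 - 1 / (finrank K V : ℝ)) * mass μ R := by
    have h1 : mass μ R / (finrank K V : ℝ) ≤ mass μ (inSub u R W) := by
      rw [div_le_iff₀ hdpos, mul_comm]
      exact hfair'
    have h2 : mass μ R' = mass μ R - mass μ (inSub u R W) := by linarith [hsplit]
    rw [h2, sub_mul, one_mul, one_div, ← div_eq_inv_mul]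
    linarith [h1]
  refine ⟨piece, ?_, ?_, ?_, ?_, ?_⟩
  · -- termination: at most `|R|` rounds
    intro x hx
    by_cases hxW : u x ∈ W
    · simp only [piece, hxW, if_true]
      exact Finset.card_pos.2 hR
    · have hxR' : x ∈ R' := by simp [hR', hx, hxW]
      have hlt := h1' x hxR'
      have hcard : R'.card < R.card := Finset.card_lt_card hR'ss
      simp only [piece, hxW, if_false]
      omega
  · -- every piece satisfies the strict subspace-mass inequality in its span
    intro i hi
    cases i with
    | zero => rw [hP0]; exact hstrict
    | succ i => rw [hPsucc] at hi ⊢; exact h2' i hi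
  · -- every piece takes at least a `1/d` fraction of what is left
    intro i
    cases i with
    | zero => rw [hT0, hP0]; exact hfair'
    | succ i => rw [hTsucc, hPsucc]; exact h3' i
  · -- sharper: at least a `dim W_i / d` fraction
    intro i
    cases i with
    | zero => rw [hT0, hP0, hspan, mul_comm (finrank K V : ℝ)]; exact hfair
    | succ i => rw [hTsucc, hPsucc]; exact h3s' i
  · -- geometric decay of the tail
    intro j
    cases j with
    | zero => simp
    | succ j =>
      rw [hTsucc]
      calc mass μ (R'.filter fun x => j ≤ piece' x)
          ≤ (1 - 1 / (finrank K V : ℝ)) ^ j * mass μ R' := h4' j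
        _ ≤ (1 - 1 / (finrank K V : ℝ)) ^ j * ((1 - 1 / (finrank K V : ℝ)) * mass μ R) :=
          mul_le_mul_of_nonneg_left hR'le (pow_nonneg hq j)
        _ = (1 - 1 / (finrank K V : ℝ)) ^ (j + 1) * mass μ R := by ring

/-- The piece count: `(1 − 1/d)^j ≤ e^{−j/d}` for `d ≥ 1`, so in `exists_decomposition` the pieces of
index `< j` capture all but an `e^{−j/d}` fraction of the mass — at most `⌈d · ln(1/η)⌉` pieces leave
an `η`-light remainder (the count behind "a decomposition of `S` into not too many subsets").
[cite: DiakonikolasKaneTzamos2021, §1.2, paragraph after Theorem 1.4] -/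
theorem one_sub_div_pow_le_exp {d : ℝ} (hd : 1 ≤ d) (j : ℕ) :
    (1 - 1 / d) ^ j ≤ Real.exp (-(j / d)) := by
  have h0 : 0 ≤ 1 - 1 / d := by
    rw [sub_nonneg, div_le_one (by linarith)]
    exact hd
  have h1 : 1 - 1 / d ≤ Real.exp (-(1 / d)) := by
    have := Real.add_one_le_exp (-(1 / d))
    linarith
  calc (1 - 1 / d) ^ j ≤ (Real.exp (-(1 / d))) ^ j := pow_le_pow_left₀ h0 h1 j
    _ = Real.exp (-(j / d)) := by
      rw [← Real.exp_nat_mul]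
      congr 1
      ring

end Dense

/-! ## The Forster decomposition in `ℝ^k`, with its transforms

On each piece the analytic half is the weighted exact radial-isotropic-position theorem PROVED in
`Literature/Computability/Complexity/ForsterIsotropicPositionProof.lean`, Part V
(`Forster.exists_isotropic_submodule`: coordinates on a subspace `V ≤ ℝ^k` of dimension `r` putting a
weighted sub-family of `V ∖ {0}` in exact radial isotropic position in `ℝ^r`, under the strict
subspace-mass inequality relative to `V`).  A strictly dense piece satisfies exactly that hypothesis
for `V =` its own span (`IsStrictlyDense.barthe`), so every piece of `exists_decomposition` carries a
Forster transform (`IsStrictlyDense.exists_isotropic`, `exists_forster_decomposition`). -/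

section Transforms

variable {X : Type} {k : ℕ} (u : X → Fin k → ℝ) (μ : X → ℝ)
variable [∀ (W : Submodule ℝ (Fin k → ℝ)) (v : Fin k → ℝ), Decidable (v ∈ W)]

/-- A strictly dense piece `T` satisfies the strict subspace-mass inequality RELATIVE TO ITS SPAN in
the sub-family form consumed by `Forster.exists_isotropic_submodule`: for every nonzero proper
`W < span (u '' T)` and every `S ⊆ T` with `u(S) ⊆ W`,
`dim(span u(T)) · μ(S) < dim W · μ(T)`. [cite: DiakonikolasKaneTzamos2021, Theorem 2.1] -/
theorem IsStrictlyDense.barthe {T : Finset X} (hμ : ∀ x ∈ T, 0 < μ x)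
    (hD : IsStrictlyDense ℝ u μ T) :
    ∀ W : Submodule ℝ (Fin k → ℝ), W ≠ ⊥ → W < Submodule.span ℝ (u '' ↑T) → ∀ S : Finset X,
      S ⊆ T → (∀ x ∈ S, u x ∈ W) →
      (finrank ℝ (Submodule.span ℝ (u '' ↑T)) : ℝ) * ∑ x ∈ S, μ x <
        finrank ℝ W * ∑ x ∈ T, μ x := by
  intro W hWb hWlt S hST hSW
  have h := hD W hWlt hWb
  have hle : ∑ x ∈ S, μ x ≤ mass μ (inSub u T W) :=
    Finset.sum_le_sum_of_subset_of_nonneg (fun x hx => (mem_inSub u).2 ⟨hST hx, hSW x hx⟩)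
      fun x hx _ => (hμ x (inSub_subset u T W hx)).le
  calc (finrank ℝ (Submodule.span ℝ (u '' ↑T)) : ℝ) * ∑ x ∈ S, μ x
      ≤ finrank ℝ (Submodule.span ℝ (u '' ↑T)) * mass μ (inSub u T W) :=
        mul_le_mul_of_nonneg_left hle (Nat.cast_nonneg _)
    _ = mass μ (inSub u T W) * finrank ℝ (Submodule.span ℝ (u '' ↑T)) := mul_comm _ _
    _ < mass μ T * finrank ℝ W := h
    _ = finrank ℝ W * ∑ x ∈ T, μ x := by rw [mass, mul_comm]

variable [Fintype X] [DecidableEq X]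

/-- **Exact weighted radial isotropic position on a strictly dense piece** (Diakonikolas–Kane–Tzamos
2021, Thm. 2.1 applied inside the span of the piece — the "Forster transform over the subspace which
it spans" of their Thm. 1.4): if `(u, μ)|_T` (nonzero vectors, positive weights) is strictly dense,
then with `W_T = span (u '' T)` of dimension `r` there are linear maps `P : ℝ^k → ℝ^r`,
`L : ℝ^r → ℝ^k` with `P ∘ L = id`, `L ∘ P = id` on `W_T`, `L(ℝ^r) ⊆ W_T` (so `P|_{W_T}` is an
isomorphism `W_T ≅ ℝ^r`), such that
`∑_{x∈T} μ_x ⟨P u_x, w⟩² / ‖P u_x‖² = (μ(T)/r) ‖w‖²` for every `w ∈ ℝ^r`.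
By `Forster.exists_isotropic_submodule` (PROVED) and `IsStrictlyDense.barthe`.
[cite: DiakonikolasKaneTzamos2021, Theorem 2.1 and Theorem 1.4] -/
theorem IsStrictlyDense.exists_isotropic {T : Finset X} (hu : ∀ x ∈ T, u x ≠ 0)
    (hμ : ∀ x ∈ T, 0 < μ x) (hD : IsStrictlyDense ℝ u μ T) :
    ∃ (P : (Fin k → ℝ) →ₗ[ℝ] (Fin (finrank ℝ (Submodule.span ℝ (u '' ↑T))) → ℝ))
      (L : (Fin (finrank ℝ (Submodule.span ℝ (u '' ↑T))) → ℝ) →ₗ[ℝ] (Fin k → ℝ)),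
      (∀ w, P (L w) = w) ∧ (∀ v ∈ Submodule.span ℝ (u '' ↑T), L (P v) = v) ∧
      (∀ w, L w ∈ Submodule.span ℝ (u '' ↑T)) ∧
      ∀ w, ∑ x ∈ T, μ x * ((P (u x) ⬝ᵥ w) ^ 2 / (P (u x) ⬝ᵥ P (u x))) =
        mass μ T / finrank ℝ (Submodule.span ℝ (u '' ↑T)) * (w ⬝ᵥ w) := by
  obtain ⟨P, L, h1, h2, h3, h4⟩ :=
    _root_.Literature.Computability.Complexity.Forster.exists_isotropic_submodule X k
      (finrank ℝ (Submodule.span ℝ (u '' ↑T))) u μ (Submodule.span ℝ (u '' ↑T)) rfl T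
      (fun x hx => Submodule.subset_span ⟨x, Finset.mem_coe.2 hx, rfl⟩) hu hμ
      (IsStrictlyDense.barthe u μ hμ hD)
  exact ⟨P, L, h1, h2, h3, fun w => by rw [mass]; exact h4 w⟩

/-- **The Forster decomposition of a weighted family in `ℝ^k`, with its transforms**
(Diakonikolas–Kane–Tzamos 2021, Thm. 1.4 and the paragraph after it; Hopkins–Kane–Lovett–Mahajan
2020, Cor. 4.20 — exact form).  Nonzero vectors `u_x ∈ ℝ^k` with weights `μ_x > 0` (`x ∈ R`) are
partitioned by a rank function `piece` (`piece x < |R|`) into pieces `T_i = {piece = i}` such that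
the tail decays, `μ{piece ≥ j} ≤ (1 − 1/k)^j μ(R)`, and EVERY nonempty piece, in its own span `W_i`
(dimension `r_i`), is in exact `μ`-weighted radial isotropic position after a linear isomorphism
`P_i : W_i ≅ ℝ^{r_i}` (section `L_i`): `∑_{x∈T_i} μ_x ⟨P_i u_x, w⟩²/‖P_i u_x‖² = (μ(T_i)/r_i)‖w‖²`.
[cite: DiakonikolasKaneTzamos2021, Theorem 1.4 and §1.2] -/
theorem exists_forster_decomposition (R : Finset X) (hu : ∀ x ∈ R, u x ≠ 0)
    (hμ : ∀ x ∈ R, 0 < μ x) :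
    ∃ piece : X → ℕ,
      (∀ x ∈ R, piece x < R.card) ∧
      (∀ j, mass μ (R.filter fun x => j ≤ piece x) ≤ (1 - 1 / (k : ℝ)) ^ j * mass μ R) ∧
      ∀ i, (R.filter fun x => piece x = i).Nonempty →
        ∃ (P : (Fin k → ℝ) →ₗ[ℝ]
            (Fin (finrank ℝ (Submodule.span ℝ (u '' ↑(R.filter fun x => piece x = i)))) → ℝ))
          (L : (Fin (finrank ℝ (Submodule.span ℝ (u '' ↑(R.filter fun x => piece x = i)))) → ℝ)
            →ₗ[ℝ] (Fin k → ℝ)),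
          (∀ w, P (L w) = w) ∧
          (∀ v ∈ Submodule.span ℝ (u '' ↑(R.filter fun x => piece x = i)), L (P v) = v) ∧
          (∀ w, L w ∈ Submodule.span ℝ (u '' ↑(R.filter fun x => piece x = i))) ∧
          ∀ w, ∑ x ∈ R.filter (fun x => piece x = i),
              μ x * ((P (u x) ⬝ᵥ w) ^ 2 / (P (u x) ⬝ᵥ P (u x))) =
            mass μ (R.filter fun x => piece x = i) /
              finrank ℝ (Submodule.span ℝ (u '' ↑(R.filter fun x => piece x = i))) * (w ⬝ᵥ w) := by
  obtain ⟨piece, h1, h2, _, _, h5⟩ := exists_decomposition ℝ u μ R hu hμ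
  refine ⟨piece, h1, fun j => ?_, fun i hi => ?_⟩
  · have := h5 j
    rwa [Module.finrank_fin_fun] at this
  · exact IsStrictlyDense.exists_isotropic u μ
      (fun x hx => hu x (Finset.mem_filter.1 hx).1) (fun x hx => hμ x (Finset.mem_filter.1 hx).1)
      (h2 i hi)

end Transforms

end ForsterDecomposition

end Literature.Computability.Complexity
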